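import Literature.Analysis.FluidPDE.LaplaceDivFormLocalisation
import Literature.Analysis.FluidPDE.NewtonPotentialRepresentation
import Literature.Analysis.FluidPDE.HarmonicProbe
import HarnessLib

/-!
# The localised weak solution of `Δw = div F` is a sum of Newtonian potentials

Analysis/FluidPDE support file on the discharge path of the named fact
`Literature.Analysis.FluidPDE.LaplaceDivFormInteriorHolder` (`NSBoundedSpatialHolder.lean`;
Gilbarg–Trudinger 2001, Thm. 8.24 for the Laplacian). Setting: `w` has weak derivative `g` on
`B = B(x₀, R)` (`HasWeakFDerivOn`), `F` is locally integrable on `B`, `∫_B g(∇φ) = ∫_B ⟨F, ∇φ⟩`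
for all `φ ∈ C_c^∞(B)`, and `χ ∈ C_c^∞(B)` is a cut-off. With the densities of the localisation
identity (`LaplaceDivFormLocalisation.integral_cutoff_mul_laplacian`)

  `w̃ = χw` (`locW`),  `f'ⱼ = χFⱼ + 2w∂ⱼχ` (`locF`),  `h' = -⟨F, ∇χ⟩ - wΔχ` (`locH`),

so that `Δw̃ = div f' + h'` in `𝓓'(ℝ³)`, this file proves the **representation formula**

  `w̃(x) = ∑ⱼ ∫ f'ⱼ(y) ∂ⱼΓ(x - y) dy + ∫ h'(y) Γ(x - y) dy`  for a.e. `x ∈ B̄(x₀, R + 1)`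

(`ae_eq_sum_potential`, under `f'ⱼ ∈ L^p`, `p > 3`, `h' ∈ L²`), whose right-hand side is the
sum of potentials estimated in `NewtonPotentialHolder` (sup norm and Hölder modulus in terms of
`‖f'‖_p`, `‖h'‖₂` only). Steps:

* the densities are integrable and vanish off `B(0, ‖x₀‖ + |R|)` (`integrable_locW/locF/locH`,
  `locW/locF/locH_eq_zero`);
* `mollified_eq_sum_potential`: for `ρ ∈ C_c^∞`, the mollification `W = ∫ w̃(y)ρ(· - y) dy` is
  `C^∞_c`, its Laplacian is computed under the integral (tree `laplacian_integral_mul_comp_sub`,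
  `HarmonicProbe`) and equals, by the localisation identity tested with `ρ(x - ·)`,
  `∑ⱼ ∂ⱼ(mollified f'ⱼ) + mollified h'` pointwise; Green's representation in divergence form
  (`NewtonPotentialRepresentation.eq_sum_potential_of_laplacian_eq`) then gives
  `W(x) = ∑ⱼ ∫ (ρ ⋆ f'ⱼ)(y) ∂ⱼΓ(x - y) dy + ∫ (ρ ⋆ h')(y) Γ(x - y) dy`;
* `tendsto_potential_normed_convolution`: along a mollifier sequence `φₙ` the potentials of
  `φₙ ⋆ f` converge to the potential of `f` on `B̄(x₀, R + 1)` (linearity, the sup bound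
  `NewtonPotentialHolder.abs_potential_le`, and `‖φₙ ⋆ f - f‖_p → 0`,
  `FunctionSpaces.tendsto_eLpNorm_normed_convolution_sub_self`);
* `ae_eq_sum_potential`: `φₙ ⋆ w̃ → w̃` a.e. (Lebesgue differentiation,
  `FunctionSpaces.ae_tendsto_normed_convolution`) and uniqueness of limits.

This is the potential-theoretic route to interior regularity (Gilbarg–Trudinger, Ch. 4:
`u = Γ ⋆ Δu` for compactly supported `u`, Lemma 4.1–4.2) carried out for `W^{1,2}` weak
solutions through mollification; no maximum principle, no Harnack inequality.

## References

* D. Gilbarg, N. S. Trudinger, *Elliptic Partial Differential Equations of Second Order*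
  (2001), (2.17), Lemma 4.1, §8.3 (localisation). [`GilbargTrudinger2001`]
* L. C. Evans, *Partial Differential Equations*, 2nd ed. (2010), App. C.4, Thm. 7
  (mollifiers: a.e. and `L^p` convergence). [`Evans2010`]
-/

noncomputable section

open MeasureTheory Set Function Filter Topology TopologicalSpace Metric
open scoped NNReal ENNReal RealInnerProductSpace Laplacian Convolution

namespace Literature.Analysis.FluidPDE

/-- Local notation for physical space `ℝ³ = EuclideanSpace ℝ (Fin 3)`. -/
local notation "ℝ³" => EuclideanSpace ℝ (Fin 3)

/-- Local notation for the standard basis vectors of `ℝ³`. -/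
local notation "𝐞" j => EuclideanSpace.single (j : Fin 3) (1 : ℝ)

namespace LaplaceDivFormMollified

open SerrinBoundedHolder LaplaceDivFormLocalisation NewtonPotentialHolder
  NewtonPotentialRepresentation

/-! ### The three densities of the localised equation -/

/-- The localised function `w̃ = χw`. [folklore] -/
def locW (χ w : ℝ³ → ℝ) : ℝ³ → ℝ := fun y => χ y * w y

/-- The divergence-form densities `f'ⱼ = χFⱼ + 2w∂ⱼχ` of `Δ(χw) = div f' + h'`
(`LaplaceDivFormLocalisation.integral_cutoff_mul_laplacian`). [folklore] -/
def locF (χ w : ℝ³ → ℝ) (F : ℝ³ → ℝ³) (j : Fin 3) : ℝ³ → ℝ :=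
  fun y => χ y * F y j + 2 * w y * fderiv ℝ χ y (𝐞 j)

/-- The zeroth-order density `h' = -⟨F, ∇χ⟩ - wΔχ` of `Δ(χw) = div f' + h'`. [folklore] -/
def locH (χ w : ℝ³ → ℝ) (F : ℝ³ → ℝ³) : ℝ³ → ℝ :=
  fun y => -(∑ j, F y j * fderiv ℝ χ y (𝐞 j)) - w y * (Δ χ) y

variable {x₀ : ℝ³} {R : ℝ} {w : ℝ³ → ℝ} {g : ℝ³ → ℝ³ →L[ℝ] ℝ} {F : ℝ³ → ℝ³} {χ : ℝ³ → ℝ}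

/-- Points of norm `> ‖x₀‖ + |R|` lie outside `B(x₀, R)`, hence outside `tsupport χ`. [folklore] -/
theorem not_mem_tsupport_of_lt_norm (hχs : tsupport χ ⊆ ball x₀ R) {z : ℝ³}
    (hz : ‖x₀‖ + |R| < ‖z‖) : z ∉ tsupport χ := by
  intro h
  have hzb := hχs h
  rw [mem_ball, dist_eq_norm] at hzb
  have h1 : ‖z‖ ≤ ‖x₀‖ + ‖z - x₀‖ := norm_le_insert' z x₀
  linarith [le_abs_self R]

section Densities

variable (hw : FunctionSpaces.HasWeakFDerivOn (⟨ball x₀ R, isOpen_ball⟩ : Opens ℝ³) volume w g)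
  (hF : LocallyIntegrableOn F (ball x₀ R) volume)
  (hχ : ContDiff ℝ (⊤ : ℕ∞) χ) (hχc : HasCompactSupport χ) (hχs : tsupport χ ⊆ ball x₀ R)

include hχs in
/-- `w̃` vanishes off `B(0, ‖x₀‖ + |R|)`. [folklore] -/
theorem locW_eq_zero {z : ℝ³} (hz : ‖x₀‖ + |R| < ‖z‖) : locW χ w z = 0 := by
  rw [locW, image_eq_zero_of_notMem_tsupport (not_mem_tsupport_of_lt_norm hχs hz), zero_mul]

include hχs in
/-- `f'ⱼ` vanishes off `B(0, ‖x₀‖ + |R|)`. [folklore] -/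
theorem locF_eq_zero (j : Fin 3) {z : ℝ³} (hz : ‖x₀‖ + |R| < ‖z‖) : locF χ w F j z = 0 := by
  have h := not_mem_tsupport_of_lt_norm hχs hz
  rw [locF, image_eq_zero_of_notMem_tsupport h, fderiv_of_notMem_tsupport ℝ h]
  simp

include hχs in
/-- `h'` vanishes off `B(0, ‖x₀‖ + |R|)`. [folklore] -/
theorem locH_eq_zero {z : ℝ³} (hz : ‖x₀‖ + |R| < ‖z‖) : locH χ w F z = 0 := by
  have h := not_mem_tsupport_of_lt_norm hχs hz
  rw [locH, fderiv_of_notMem_tsupport ℝ h, laplacian_eq_zero_of_notMem_tsupport h]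
  simp

include hχ hχc hχs in
/-- `χ` is a test function on the ball. [folklore] -/
theorem isTestFunctionOn_cutoff :
    FunctionSpaces.IsTestFunctionOn (⟨ball x₀ R, isOpen_ball⟩ : Opens ℝ³) χ := ⟨hχ, hχc, hχs⟩

include hχ hχc hχs in
/-- `Δχ` is a test function on the ball. [folklore] -/
theorem isTestFunctionOn_laplacian_cutoff :
    FunctionSpaces.IsTestFunctionOn (⟨ball x₀ R, isOpen_ball⟩ : Opens ℝ³) (Δ χ) where
  contDiff := contDiff_laplacian (n := (⊤ : ℕ∞)) (by exact_mod_cast hχ)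
  hasCompactSupport :=
    HasCompactSupport.intro hχc fun z hz => laplacian_eq_zero_of_notMem_tsupport hz
  tsupport_subset := by
    refine (closure_minimal (fun z hz => ?_) (isClosed_tsupport χ)).trans hχs
    by_contra h
    exact hz (laplacian_eq_zero_of_notMem_tsupport h)

/-- From integrability on the ball to integrability, for functions vanishing with `χ`. [folklore] -/
theorem integrable_of_integrableOn_ball {f : ℝ³ → ℝ} (hχs : tsupport χ ⊆ ball x₀ R)
    (hf : IntegrableOn f (ball x₀ R) volume) (h0 : ∀ z, z ∉ tsupport χ → f z = 0) :
    Integrable f volume := by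
  refine (integrableOn_iff_integrable_of_support_subset (s := ball x₀ R) fun z hz => ?_).1 hf
  by_contra hzb
  exact (Function.mem_support.1 hz) (h0 z fun h => hzb (hχs h))

include hw hχ hχc hχs in
/-- `w̃ = χw` is integrable. [folklore] -/
theorem integrable_locW : Integrable (locW χ w) volume := by
  refine integrable_of_integrableOn_ball hχs ?_ fun z hz => ?_
  · exact integrableOn_test_mul (U := ⟨ball x₀ R, isOpen_ball⟩) hχ.continuous hχc hχs
      hw.locallyIntegrableOn
  · rw [locW, image_eq_zero_of_notMem_tsupport hz, zero_mul]

include hw hF hχ hχc hχs in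
/-- `f'ⱼ` is integrable. [folklore] -/
theorem integrable_locF (j : Fin 3) : Integrable (locF χ w F j) volume := by
  have hχT := isTestFunctionOn_cutoff hχ hχc hχs
  have hdχT := isTestFunctionOn_fderiv_apply hχT (𝐞 j)
  refine integrable_of_integrableOn_ball hχs ?_ fun z hz => ?_
  · have h1 : IntegrableOn (fun y => χ y * F y j) (ball x₀ R) volume :=
      integrableOn_test_mul (U := ⟨ball x₀ R, isOpen_ball⟩) hχ.continuous hχc hχs
        ((EuclideanSpace.proj j : ℝ³ →L[ℝ] ℝ).locallyIntegrableOn_comp hF)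
    have h2 : IntegrableOn (fun y => fderiv ℝ χ y (𝐞 j) * w y) (ball x₀ R) volume :=
      integrableOn_test_mul (U := ⟨ball x₀ R, isOpen_ball⟩) hdχT.contDiff.continuous
        hdχT.hasCompactSupport hdχT.tsupport_subset hw.locallyIntegrableOn
    refine (h1.add (h2.const_mul 2)).congr_fun (fun y _ => ?_) measurableSet_ball
    simp only [locF, Pi.add_apply]
    ring
  · rw [locF, image_eq_zero_of_notMem_tsupport hz, fderiv_of_notMem_tsupport ℝ hz]
    simp

include hw hF hχ hχc hχs in
/-- `h'` is integrable. [folklore] -/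
theorem integrable_locH : Integrable (locH χ w F) volume := by
  have hχT := isTestFunctionOn_cutoff hχ hχc hχs
  have hdχT := fun j : Fin 3 => isTestFunctionOn_fderiv_apply hχT (𝐞 j)
  have hΔT := isTestFunctionOn_laplacian_cutoff hχ hχc hχs
  refine integrable_of_integrableOn_ball hχs ?_ fun z hz => ?_
  · have h1 : ∀ j : Fin 3, IntegrableOn (fun y => fderiv ℝ χ y (𝐞 j) * F y j) (ball x₀ R)
        volume := fun j =>
      integrableOn_test_mul (U := ⟨ball x₀ R, isOpen_ball⟩) (hdχT j).contDiff.continuous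
        (hdχT j).hasCompactSupport (hdχT j).tsupport_subset
        ((EuclideanSpace.proj j : ℝ³ →L[ℝ] ℝ).locallyIntegrableOn_comp hF)
    have h2 : IntegrableOn (fun y => (Δ χ) y * w y) (ball x₀ R) volume :=
      integrableOn_test_mul (U := ⟨ball x₀ R, isOpen_ball⟩) hΔT.contDiff.continuous
        hΔT.hasCompactSupport hΔT.tsupport_subset hw.locallyIntegrableOn
    have h3 : IntegrableOn (fun y => -(∑ j, fderiv ℝ χ y (𝐞 j) * F y j) - (Δ χ) y * w y)
        (ball x₀ R) volume := (integrable_finsetSum (s := Finset.univ) fun j _ => h1 j).neg.sub h2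
    refine h3.congr_fun (fun y _ => ?_) measurableSet_ball
    show -(∑ j, fderiv ℝ χ y (𝐞 j) * F y j) - (Δ χ) y * w y = locH χ w F y
    rw [locH]
    congr 1
    · congr 1
      exact Finset.sum_congr rfl fun j _ => mul_comm _ _
    · exact mul_comm _ _
  · rw [locH, fderiv_of_notMem_tsupport ℝ hz, laplacian_eq_zero_of_notMem_tsupport hz]
    simp

end Densities

/-! ### Compact support of the mollifications -/

/-- The mollification `y ↦ ∫ k(z) ρ(y - z) dz` of a function `k` vanishing off `B̄(0, ρ₀)` by a
compactly supported `ρ` has compact support. [folklore] -/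
theorem hasCompactSupport_integral_mul_comp_sub {k ρ : ℝ³ → ℝ} {ρ₀ : ℝ}
    (hk : ∀ z, ρ₀ < ‖z‖ → k z = 0) (hρc : HasCompactSupport ρ) :
    HasCompactSupport fun y => ∫ z, k z * ρ (y - z) := by
  obtain ⟨r, hr⟩ := hρc.isCompact.isBounded.subset_closedBall (0 : ℝ³)
  refine HasCompactSupport.intro (isCompact_closedBall (0 : ℝ³) (|ρ₀| + |r|)) fun y hy => ?_
  rw [mem_closedBall_zero_iff, not_le] at hy
  refine integral_eq_zero_of_ae (Eventually.of_forall fun z => ?_)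
  by_cases hz : ρ₀ < ‖z‖
  · simp [hk z hz]
  · have hz' : ‖z‖ ≤ |ρ₀| := (not_lt.1 hz).trans (le_abs_self ρ₀)
    have hyz : y - z ∉ tsupport ρ := by
      intro h
      have h1 : ‖y - z‖ ≤ r := mem_closedBall_zero_iff.1 (hr h)
      have h2 : ‖y‖ ≤ ‖y - z‖ + ‖z‖ := norm_le_norm_sub_add y z
      linarith [le_abs_self r]
    simp [image_eq_zero_of_notMem_tsupport hyz]

/-! ### The mollified localised solution is a sum of potentials -/

/-- **The mollified localised weak solution as a sum of potentials.** Let `w` have weak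
derivative `g` on `B = B(x₀, R)`, `F` be locally integrable on `B`, `∫_B g(∇φ) = ∫_B ⟨F, ∇φ⟩`
for all `φ ∈ C_c^∞(B)`, and `χ ∈ C_c^∞(B)`. For every `ρ ∈ C_c^∞(ℝ³)`, the mollification
`W(x) = ∫ w̃(y) ρ(x - y) dy` of `w̃ = χw` satisfies

  `W(x) = ∑ⱼ ∫ (ρ-mollification of f'ⱼ)(y) ∂ⱼΓ(x - y) dy + ∫ (ρ-mollification of h')(y) Γ(x - y) dy`,

`f'ⱼ = χFⱼ + 2w∂ⱼχ`, `h' = -⟨F, ∇χ⟩ - wΔχ`: `W ∈ C^∞_c`, its Laplacian is computed under the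
integral (`laplacian_integral_mul_comp_sub`) and, by the localisation identity
`integral_cutoff_mul_laplacian` with the test function `ρ(y - ·)`, equals
`∑ⱼ ∂ⱼ(mollified f'ⱼ) + mollified h'` pointwise; then Green's representation in divergence
form (`eq_sum_potential_of_laplacian_eq`) applies. [folklore] -/
theorem mollified_eq_sum_potential
    (hw : FunctionSpaces.HasWeakFDerivOn (⟨ball x₀ R, isOpen_ball⟩ : Opens ℝ³) volume w g)
    (hF : LocallyIntegrableOn F (ball x₀ R) volume)
    (heq : ∀ φ : ℝ³ → ℝ, FunctionSpaces.IsTestFunctionOn (⟨ball x₀ R, isOpen_ball⟩ : Opens ℝ³) φ →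
      ∫ x in ball x₀ R, g x (gradient φ x) = ∫ x in ball x₀ R, ⟪F x, gradient φ x⟫)
    (hχ : ContDiff ℝ (⊤ : ℕ∞) χ) (hχc : HasCompactSupport χ) (hχs : tsupport χ ⊆ ball x₀ R)
    {ρ : ℝ³ → ℝ} (hρ : ContDiff ℝ (⊤ : ℕ∞) ρ) (hρc : HasCompactSupport ρ) (x : ℝ³) :
    ∫ y, locW χ w y * ρ (x - y) =
      (∑ j, ∫ y, (∫ z, locF χ w F j z * ρ (y - z)) * newtonKernelGrad j (x - y)) +
        ∫ y, (∫ z, locH χ w F z * ρ (y - z)) * newtonKernel (x - y) := by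
  -- vanishing and integrability of the densities
  have hk0 : ∀ z, ‖x₀‖ + |R| < ‖z‖ → locW χ w z = 0 := fun z hz => locW_eq_zero hχs hz
  have hk1 : ∀ (j : Fin 3) z, ‖x₀‖ + |R| < ‖z‖ → locF χ w F j z = 0 := fun j z hz =>
    locF_eq_zero hχs j hz
  have hk2 : ∀ z, ‖x₀‖ + |R| < ‖z‖ → locH χ w F z = 0 := fun z hz => locH_eq_zero hχs hz
  have hWi := integrable_locW hw hχ hχc hχs
  have hFi := integrable_locF hw hF hχ hχc hχs
  have hHi := integrable_locH hw hF hχ hχc hχs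
  have hρ2 : ContDiff ℝ 2 ρ := hρ.of_le (by norm_cast)
  have hρ1 : ContDiff ℝ 1 ρ := hρ.of_le (by norm_cast)
  have hρ0 : ContDiff ℝ 0 ρ := hρ.of_le (by norm_cast)
  -- the three mollifications
  set Wm : ℝ³ → ℝ := fun y => ∫ z, locW χ w z * ρ (y - z) with hWm
  set Gm : Fin 3 → ℝ³ → ℝ := fun j y => ∫ z, locF χ w F j z * ρ (y - z) with hGm
  set Hm : ℝ³ → ℝ := fun y => ∫ z, locH χ w F z * ρ (y - z) with hHm
  -- smoothness
  have hWm2 : ContDiff ℝ 2 Wm := by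
    have h := contDiff_integral_smul_comp_sub hWi hk0 2 hρ2
    simp only [smul_eq_mul] at h
    exact h
  have hGm1 : ∀ j, ContDiff ℝ 1 (Gm j) := by
    intro j
    have h := contDiff_integral_smul_comp_sub (hFi j) (hk1 j) 1 hρ1
    simp only [smul_eq_mul] at h
    exact h
  have hHm0 : Continuous Hm := by
    have h := contDiff_integral_smul_comp_sub hHi hk2 0 hρ0
    simp only [smul_eq_mul] at h
    exact contDiff_zero.1 (by exact_mod_cast h)
  -- compact supports
  have hWmc : HasCompactSupport Wm := hasCompactSupport_integral_mul_comp_sub hk0 hρc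
  have hGmc : ∀ j, HasCompactSupport (Gm j) := fun j =>
    hasCompactSupport_integral_mul_comp_sub (hk1 j) hρc
  have hHmc : HasCompactSupport Hm := hasCompactSupport_integral_mul_comp_sub hk2 hρc
  -- the Laplacian of the mollification
  have hΔ : ∀ y, (Δ Wm) y = ∑ j, fderiv ℝ (Gm j) y (𝐞 j) + Hm y := by
    intro y
    have hL : (Δ Wm) y = ∫ z, locW χ w z * (Δ ρ) (y - z) :=
      laplacian_integral_mul_comp_sub hWi hk0 hρ2 y
    rw [hL]
    -- the localisation identity with the test function `ρ(y - ·)`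
    have hψ : ContDiff ℝ (⊤ : ℕ∞) fun z => ρ (y - z) := hρ.comp (contDiff_const.sub contDiff_id)
    have hG1 := integral_cutoff_mul_laplacian hw hF heq hχ hχc hχs hψ
    have hΔψ : ∀ z, (Δ fun z => ρ (y - z)) z = (Δ ρ) (y - z) := fun z =>
      laplacian_comp_const_sub ρ y z
    have hdψ : ∀ z (j : Fin 3), fderiv ℝ (fun z => ρ (y - z)) z (𝐞 j) =
        -fderiv ℝ ρ (y - z) (𝐞 j) := by
      intro z j
      rw [fderiv_comp_const_sub ρ y z]
      rfl
    simp_rw [hΔψ, hdψ, mul_neg, integral_neg, Finset.sum_neg_distrib, neg_neg] at hG1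
    -- pass from set integrals to integrals over `ℝ³`
    have hs0 : ∫ z in ball x₀ R, χ z * w z * (Δ ρ) (y - z) = ∫ z, locW χ w z * (Δ ρ) (y - z) := by
      refine setIntegral_eq_integral_of_forall_compl_eq_zero fun z hz => ?_
      have hz' : z ∉ tsupport χ := fun h => hz (hχs h)
      rw [image_eq_zero_of_notMem_tsupport hz']
      simp
    have hs1 : ∀ j : Fin 3, ∫ z in ball x₀ R, (χ z * F z j + 2 * w z * fderiv ℝ χ z (𝐞 j)) *
        fderiv ℝ ρ (y - z) (𝐞 j) = ∫ z, locF χ w F j z * fderiv ℝ ρ (y - z) (𝐞 j) := by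
      intro j
      refine setIntegral_eq_integral_of_forall_compl_eq_zero fun z hz => ?_
      have hz' : z ∉ tsupport χ := fun h => hz (hχs h)
      rw [image_eq_zero_of_notMem_tsupport hz', fderiv_of_notMem_tsupport ℝ hz']
      simp
    have hs2 : ∫ z in ball x₀ R, (-(∑ j, F z j * fderiv ℝ χ z (𝐞 j)) - w z * (Δ χ) z) *
        ρ (y - z) = ∫ z, locH χ w F z * ρ (y - z) := by
      refine setIntegral_eq_integral_of_forall_compl_eq_zero fun z hz => ?_
      have hz' : z ∉ tsupport χ := fun h => hz (hχs h)
      rw [fderiv_of_notMem_tsupport ℝ hz', laplacian_eq_zero_of_notMem_tsupport hz']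
      simp
    have hs0' : ∫ z in ball x₀ R, χ z * w z * (Δ ρ) (y - z) =
        ∫ z in ball x₀ R, χ z * w z * (Δ ρ) (y - z) := rfl
    rw [hs0, Finset.sum_congr rfl fun j _ => hs1 j, hs2] at hG1
    rw [hG1]
    -- the derivatives of the mollified `f'ⱼ`
    congr 1
    refine Finset.sum_congr rfl fun j _ => ?_
    have h := fderiv_integral_smul_comp_sub_apply (hFi j) (hk1 j) hρ1 y (𝐞 j)
    simp only [smul_eq_mul] at h
    exact h.symm
  -- Green's representation in divergence form
  have key := eq_sum_potential_of_laplacian_eq hWm2 hWmc hGm1 hGmc hHm0 hHmc hΔ x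
  exact key

/-! ### Passage to the limit along a mollifier sequence -/

/-- The tree's mollification `φ.normed ⋆ h` in the form `∫ h(y) ρ(x - y) dy`. [folklore] -/
theorem normed_convolution_eq (φ : ContDiffBump (0 : ℝ³)) (h : ℝ³ → ℝ) (x : ℝ³) :
    (φ.normed volume ⋆[ContinuousLinearMap.lsmul ℝ ℝ, volume] h) x =
      ∫ y, h y * φ.normed volume (x - y) := by
  rw [convolution_lsmul_swap]
  refine integral_congr_ae (Eventually.of_forall fun y => ?_)
  simp only [smul_eq_mul]
  ring

/-- Supports of mollifications by a bump of outer radius `≤ 1` of a function vanishing off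
`tsupport χ ⊆ B(x₀, R)` lie in `B(x₀, R + 1)`. [folklore] -/
theorem support_integral_mul_normed_subset (hχs : tsupport χ ⊆ ball x₀ R) {k : ℝ³ → ℝ}
    (hk : ∀ z, z ∉ tsupport χ → k z = 0) (φ : ContDiffBump (0 : ℝ³)) (hφ : φ.rOut ≤ 1) :
    (support fun y => ∫ z, k z * φ.normed volume (y - z)) ⊆ ball x₀ (R + 1) := by
  intro y hy
  by_contra hyb
  refine hy (integral_eq_zero_of_ae (Eventually.of_forall fun z => ?_))
  by_cases hz : z ∈ tsupport χ
  · have hzb := hχs hz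
    rw [mem_ball] at hzb
    rw [mem_ball, not_lt] at hyb
    have hφ0 : φ.normed volume (y - z) = 0 := by
      rw [← Function.notMem_support, φ.support_normed_eq, mem_ball_zero_iff, not_lt,
        ← dist_eq_norm]
      linarith [dist_triangle y z x₀]
    simp [hφ0]
  · simp [hk z hz]

/-- A function vanishing off `tsupport χ ⊆ B(x₀, R)` has support in `B(x₀, R + 1)`. [folklore] -/
theorem support_subset_ball_of_cutoff (hχs : tsupport χ ⊆ ball x₀ R) {k : ℝ³ → ℝ}
    (hk : ∀ z, z ∉ tsupport χ → k z = 0) : support k ⊆ ball x₀ (R + 1) := by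
  intro z hz
  have : z ∈ tsupport χ := by
    by_contra h
    exact (Function.mem_support.1 hz) (hk z h)
  exact ball_subset_ball (by linarith) (hχs this)

/-- **Convergence of the potentials of mollified densities.** For a singular kernel `k` of
degree `-a`, conjugate exponents with `aq < 3`, a density `f ∈ L^p` vanishing off
`tsupport χ ⊆ B(x₀, R)`, a mollifier sequence `φₙ` with `rOut(φₙ) → 0`, and
`x ∈ B̄(x₀, R + 1)`: `∫ (φₙ ⋆ f)(y) k(x - y) dy → ∫ f(y) k(x - y) dy` (linearity and the sup
bound `NewtonPotentialHolder.abs_potential_le`, with `‖φₙ ⋆ f - f‖_p → 0`,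
`FunctionSpaces.tendsto_eLpNorm_normed_convolution_sub_self`). [folklore] -/
theorem tendsto_potential_normed_convolution {k : ℝ³ → ℝ} {a A B : ℝ}
    (hk : IsSingularKernel k a A B) (hA : 0 ≤ A) {p q : ℝ} (hpq : p.HolderConjugate q)
    (haq : a * q < 3) (hR : 0 < R) (hχs : tsupport χ ⊆ ball x₀ R) {f : ℝ³ → ℝ}
    (hf : MemLp f (ENNReal.ofReal p) volume) (hf0 : ∀ z, z ∉ tsupport χ → f z = 0)
    {φ : ℕ → ContDiffBump (0 : ℝ³)} (hφ : Tendsto (fun n => (φ n).rOut) atTop (𝓝 0))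
    {x : ℝ³} (hx : x ∈ closedBall x₀ (R + 1)) :
    Tendsto (fun n => ∫ y, (∫ z, f z * (φ n).normed volume (y - z)) * k (x - y)) atTop
      (𝓝 (∫ y, f y * k (x - y))) := by
  have hp1 : 1 ≤ ENNReal.ofReal p := by
    rw [← ENNReal.ofReal_one]; exact ENNReal.ofReal_le_ofReal hpq.lt.le
  have hp0 : 0 < p := hpq.pos
  have hR1 : 0 < R + 1 := by linarith
  -- eventually `rOut ≤ 1`
  have hev : ∀ᶠ n in atTop, (φ n).rOut ≤ 1 :=
    (hφ.eventually (Iic_mem_nhds one_pos)).mono fun n hn => hn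
  -- the mollified densities
  set fm : ℕ → ℝ³ → ℝ := fun n y => ∫ z, f z * (φ n).normed volume (y - z) with hfm
  have hfm_eq : ∀ n, fm n = (φ n).normed volume ⋆[ContinuousLinearMap.lsmul ℝ ℝ, volume] f := by
    intro n
    funext y
    rw [normed_convolution_eq]
  have hfmp : ∀ n, MemLp (fm n) (ENNReal.ofReal p) volume := fun n => by
    rw [hfm_eq]
    exact FunctionSpaces.memLp_normed_convolution (φ n) hf hp1
  have hfsupp : support f ⊆ ball x₀ (R + 1) := support_subset_ball_of_cutoff hχs hf0
  have hfmsupp : ∀ᶠ n in atTop, support (fm n) ⊆ ball x₀ (R + 1) :=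
    hev.mono fun n hn => support_integral_mul_normed_subset hχs hf0 (φ n) hn
  -- `L^p` convergence of the mollifications
  have hLp : Tendsto (fun n => eLpNorm (fm n - f) (ENNReal.ofReal p) volume) atTop (𝓝 0) := by
    have h := FunctionSpaces.tendsto_eLpNorm_normed_convolution_sub_self (μ := volume) hφ hp1
      ENNReal.ofReal_ne_top hf
    refine h.congr fun n => ?_
    rw [hfm_eq]
  -- the sup-bound constant
  set Csup : ℝ := A * (3 * (volume : Measure ℝ³).real (ball 0 1) / (3 - a * q)) ^ (1 / q) *
    (2 * (R + 1)) ^ (3 / q - a) with hCsup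
  -- the difference of the potentials is the potential of the difference
  have hdiff : ∀ᶠ n in atTop, (∫ y, fm n y * k (x - y)) - ∫ y, f y * k (x - y) =
      ∫ y, (fm n - f) y * k (x - y) := by
    filter_upwards [hfmsupp] with n hn
    rw [← integral_sub (integrable_mul_kernel hk hA hpq haq (hfmp n) hn x)
      (integrable_mul_kernel hk hA hpq haq hf hfsupp x)]
    refine integral_congr_ae (Eventually.of_forall fun y => ?_)
    simp only [Pi.sub_apply]
    ring
  -- the bound
  have hbound : ∀ᶠ n in atTop, |(∫ y, fm n y * k (x - y)) - ∫ y, f y * k (x - y)| ≤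
      Csup * (eLpNorm (fm n - f) (ENNReal.ofReal p) volume).toReal := by
    filter_upwards [hdiff, hfmsupp] with n hn hns
    rw [hn]
    have hsub : MemLp (fm n - f) (ENNReal.ofReal p) volume := (hfmp n).sub hf
    have hsupp : support (fm n - f) ⊆ ball x₀ (R + 1) := by
      intro y hy
      rw [Function.mem_support, Pi.sub_apply] at hy
      by_contra hyb
      have h1 : fm n y = 0 := Function.notMem_support.1 fun h => hyb (hns h)
      have h2 : f y = 0 := Function.notMem_support.1 fun h => hyb (hfsupp h)
      exact hy (by rw [h1, h2, sub_zero])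
    have h := abs_potential_le hk hA hpq haq hsub hR1 hsupp hx
    rw [eLpNorm_eq_lintegral_rpow_enorm_toReal (by positivity) ENNReal.ofReal_ne_top,
      ENNReal.toReal_ofReal hp0.le]
    exact h
  -- conclusion
  have hto0 : Tendsto (fun n => Csup * (eLpNorm (fm n - f) (ENNReal.ofReal p) volume).toReal)
      atTop (𝓝 0) := by
    have h := (ENNReal.tendsto_toReal ENNReal.zero_ne_top).comp hLp
    rw [ENNReal.toReal_zero] at h
    simpa using h.const_mul Csup
  rw [tendsto_iff_norm_sub_tendsto_zero]
  refine squeeze_zero' (Eventually.of_forall fun n => norm_nonneg _) ?_ hto0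
  filter_upwards [hbound] with n hn
  rw [Real.norm_eq_abs]
  exact hn

/-- **The localised weak solution is a sum of potentials.** Under the hypotheses of
`mollified_eq_sum_potential`, if moreover `f'ⱼ ∈ L^p(ℝ³)` for some `p > 3` and
`h' ∈ L²(ℝ³)`, then for a.e. `x ∈ B̄(x₀, R + 1)`,
`χ(x)w(x) = ∑ⱼ ∫ f'ⱼ(y) ∂ⱼΓ(x - y) dy + ∫ h'(y) Γ(x - y) dy`: along a mollifier sequence `φₙ`
(`FunctionSpaces.exists_contDiffBump_seq`) the mollifications `φₙ ⋆ w̃` converge to `w̃` a.e.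
(Lebesgue differentiation, `FunctionSpaces.ae_tendsto_normed_convolution`) while, by
`mollified_eq_sum_potential`, they equal the potentials of the mollified densities, which
converge pointwise on `B̄(x₀, R + 1)` (`tendsto_potential_normed_convolution` with the singular
kernels `∂ⱼΓ` (degree `-2`, needs `p > 3`) and `Γ` (degree `-1`, with `L²`)). [folklore] -/
theorem ae_eq_sum_potential
    (hw : FunctionSpaces.HasWeakFDerivOn (⟨ball x₀ R, isOpen_ball⟩ : Opens ℝ³) volume w g)
    (hF : LocallyIntegrableOn F (ball x₀ R) volume)
    (heq : ∀ φ : ℝ³ → ℝ, FunctionSpaces.IsTestFunctionOn (⟨ball x₀ R, isOpen_ball⟩ : Opens ℝ³) φ →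
      ∫ x in ball x₀ R, g x (gradient φ x) = ∫ x in ball x₀ R, ⟪F x, gradient φ x⟫)
    (hχ : ContDiff ℝ (⊤ : ℕ∞) χ) (hχc : HasCompactSupport χ) (hχs : tsupport χ ⊆ ball x₀ R)
    (hR : 0 < R) {p : ℝ} (hp : 3 < p) (hFp : ∀ j, MemLp (locF χ w F j) (ENNReal.ofReal p) volume)
    (hH2 : MemLp (locH χ w F) 2 volume) :
    ∀ᵐ x ∂(volume : Measure ℝ³), x ∈ closedBall x₀ (R + 1) →
      locW χ w x = (∑ j, ∫ y, locF χ w F j y * newtonKernelGrad j (x - y)) +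
        ∫ y, locH χ w F y * newtonKernel (x - y) := by
  obtain ⟨φ, hφ0, hφ2⟩ := FunctionSpaces.exists_contDiffBump_seq (E := ℝ³)
  -- a.e. convergence of the mollifications of `w̃`
  have hWi := integrable_locW hw hχ hχc hχs
  have hae := FunctionSpaces.ae_tendsto_normed_convolution hφ0 hφ2 hWi.locallyIntegrable
  filter_upwards [hae] with x hx hxB
  -- the identity for each `n`
  have hn : ∀ n, ∫ y, locW χ w y * (φ n).normed volume (x - y) =
      (∑ j, ∫ y, (∫ z, locF χ w F j z * (φ n).normed volume (y - z)) *
          newtonKernelGrad j (x - y)) +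
        ∫ y, (∫ z, locH χ w F z * (φ n).normed volume (y - z)) * newtonKernel (x - y) :=
    fun n => mollified_eq_sum_potential hw hF heq hχ hχc hχs (φ n).contDiff_normed
      (φ n).hasCompactSupport_normed x
  -- the left-hand sides converge to `w̃ x`
  have hL : Tendsto (fun n => ∫ y, locW χ w y * (φ n).normed volume (x - y)) atTop
      (𝓝 (locW χ w x)) := by
    refine hx.congr fun n => ?_
    rw [normed_convolution_eq]
  -- the right-hand sides converge to the potentials
  have hq₁ := Real.HolderConjugate.conjExponent (show (1 : ℝ) < p by linarith)
  have hq₁' : 2 * Real.conjExponent p < 3 := by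
    rw [Real.conjExponent, mul_div_assoc', div_lt_iff₀ (by linarith)]
    linarith
  have h22 : (2 : ℝ).HolderConjugate 2 := by
    rw [Real.holderConjugate_iff]; norm_num
  have hF0 : ∀ (j : Fin 3) z, z ∉ tsupport χ → locF χ w F j z = 0 := by
    intro j z hz
    rw [locF, image_eq_zero_of_notMem_tsupport hz, fderiv_of_notMem_tsupport ℝ hz]
    simp
  have hH0 : ∀ z, z ∉ tsupport χ → locH χ w F z = 0 := by
    intro z hz
    rw [locH, fderiv_of_notMem_tsupport ℝ hz, laplacian_eq_zero_of_notMem_tsupport hz]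
    simp
  have hH2' : MemLp (locH χ w F) (ENNReal.ofReal 2) volume := by
    rw [ENNReal.ofReal_ofNat]; exact hH2
  have hR : Tendsto (fun n => (∑ j, ∫ y, (∫ z, locF χ w F j z * (φ n).normed volume (y - z)) *
          newtonKernelGrad j (x - y)) +
        ∫ y, (∫ z, locH χ w F z * (φ n).normed volume (y - z)) * newtonKernel (x - y)) atTop
      (𝓝 ((∑ j, ∫ y, locF χ w F j y * newtonKernelGrad j (x - y)) +
        ∫ y, locH χ w F y * newtonKernel (x - y))) := by
    refine Tendsto.add (tendsto_finsetSum _ fun j _ => ?_) ?_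
    · exact tendsto_potential_normed_convolution (isSingularKernel_newtonKernelGrad j)
        (by positivity) hq₁ hq₁' hR hχs (hFp j) (hF0 j) hφ0 hxB
    · exact tendsto_potential_normed_convolution isSingularKernel_newtonKernel (by positivity)
        h22 (by norm_num) hR hχs hH2' hH0 hφ0 hxB
  exact tendsto_nhds_unique (hL.congr hn) hR

end LaplaceDivFormMollified

end Literature.Analysis.FluidPDE
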